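import Summits.CriticalPhenomena.Ising3D.ExclusionSentencesPiForms

/-!
# Exclusion sentences — the `π` / `log 2` part of family `LIN` in kernel form, and the bridges for the
`π`-forms (cell `pub-ising3x`, seat recog-1)

HONEST FRAMING: lottery ticket; floor = tightest certified 3D Ising CFT bounds; no exact-solution
claim without a proof.

`LINπ` ⊂ LIN (FAMILIES-v1, SCOPE.md §3.1): `x = (a₀ + c₁π + c₂π² + c₃π³ + c₄ log 2)/aₓ` with at most two of
`c₁…c₄` non-zero and not all zero, `|cᵢ| ≤ H`, `1 ≤ aₓ ≤ H`, `a₀ ∈ ℤ` free — the LIN members that avoid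
`ζ(3)`, `ζ(5)` and Catalan's constant (for which Mathlib has no certified digits). As for `ALG`, the free
coefficient `a₀` is SOLVED from the interval: `a·aₓ − Σcᵢ Kᵢ ≤ a₀ ≤ b·aₓ − Σcᵢ Kᵢ` with the sum enclosed by
the rational interval arithmetic of `ExclusionSentencesPiForms.lean`; each candidate is decidably outside
`[a, b]` or must be listed (up to proportionality of the tuple `(a₀, c, aₓ)`).
* `linVal 0 [c₁, c₂, c₃, c₄] = c₁π + c₂π² + c₃π³ + c₄ log 2` (`linVal_four`), enclosure `linEncl`
  (`linVal_mem`); `linPiFamily H`; checker `linPiExcluded H a b ex` (coefficient vectors by `loopNZ`, a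
  bounded loop with a budget of non-zero entries) and `linPiExcluded_sound`: every member in `[a, b]` equals
  the value `linTupleVal e` of a listed tuple;
* bridges from the floor's statement `IsingEnclosure W R` for both `π`-sub-families:
  `sigma_trgPi_covered_of_isingEnclosure`, `eps_trgPi_covered_of_isingEnclosure`,
  `sigma_linPi_covered_of_isingEnclosure`, `eps_linPi_covered_of_isingEnclosure`.
No 3D digit is used; instances live in `ExclusionSentencesControl2DPi.lean`.
-/

namespace Summit.CriticalPhenomena.Ising3D

open Literature.MathematicalPhysics.QuantumFieldTheory.ConformalBootstrap3D

/-! ### The constants `K = (π, π², π³, log 2)` and integer combinations -/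

/-- Enclosure of `K_i` (`i = 0, 1, 2`: `π, π², π³`; otherwise `log 2`). -/
def kI : ℕ → ℚ × ℚ
  | 0 => piI
  | 1 => powI piI 2
  | 2 => powI piI 3
  | _ => log2I

/-- The constant `K_i` (`i = 0, 1, 2`: `π, π², π³`; otherwise `log 2`). -/
noncomputable def kVal : ℕ → ℝ
  | 0 => Real.pi
  | 1 => Real.pi ^ 2
  | 2 => Real.pi ^ 3
  | _ => Real.log 2

/-- Soundness of `kI`. -/
theorem kVal_mem (i : ℕ) : kVal i ∈ InI (kI i) := by
  have hpi : (0 : ℚ) ≤ piI.1 := by norm_num [piI]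
  match i with
  | 0 => exact pi_mem_piI
  | 1 => exact powI_sound hpi pi_mem_piI 2
  | 2 => exact powI_sound hpi pi_mem_piI 3
  | n + 3 => exact log2_mem_log2I

/-- `linVal i [cᵢ, cᵢ₊₁, …] = Σ_j c_j K_j` (coefficients attached to consecutive constants from index `i`). -/
noncomputable def linVal : ℕ → List ℤ → ℝ
  | _, [] => 0
  | i, c :: cs => (c : ℝ) * kVal i + linVal (i + 1) cs

/-- The printed form: `linVal 0 [c₁, c₂, c₃, c₄] = c₁ π + c₂ π² + c₃ π³ + c₄ log 2`. -/
theorem linVal_four (c₁ c₂ c₃ c₄ : ℤ) :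
    linVal 0 [c₁, c₂, c₃, c₄] = c₁ * Real.pi + c₂ * Real.pi ^ 2 + c₃ * Real.pi ^ 3 + c₄ * Real.log 2 := by
  simp only [linVal, kVal]; ring

/-- Rational enclosure of `linVal i c`. -/
def linEncl : ℕ → List ℤ → ℚ × ℚ
  | _, [] => (0, 0)
  | i, c :: cs => addI (smulI c (kI i)) (linEncl (i + 1) cs)

/-- Soundness of `linEncl`. -/
theorem linVal_mem : ∀ (i : ℕ) (c : List ℤ), linVal i c ∈ InI (linEncl i c)
  | _, [] => by simp [linVal, linEncl, InI]
  | i, c :: cs => by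
      simp only [linVal, linEncl]
      exact addI_sound (smulI_sound c (kVal_mem i)) (linVal_mem (i + 1) cs)

/-- Proportional coefficient lists give proportional values. -/
theorem linVal_mul_eq {t t' : ℤ} : ∀ (i : ℕ) (c c' : List ℤ),
    c.map (· * t) = c'.map (· * t') → linVal i c * t = linVal i c' * t'
  | _, [], c', h => by
      have : c' = [] := by simpa using h.symm
      subst this; simp [linVal]
  | i, v :: cs, c', h => by
      match c', h with
      | v' :: cs', h =>
        simp only [List.map_cons, List.cons.injEq] at h
        obtain ⟨hv, hcs⟩ := h
        have ih := linVal_mul_eq (i + 1) cs cs' hcs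
        have hv' : (v : ℝ) * t = v' * t' := by exact_mod_cast hv
        simp only [linVal]
        calc ((v : ℝ) * kVal i + linVal (i + 1) cs) * t = (v : ℝ) * t * kVal i + linVal (i + 1) cs * t := by ring
          _ = (v' : ℝ) * t' * kVal i + linVal (i + 1) cs' * t' := by rw [hv', ih]
          _ = ((v' : ℝ) * kVal i + linVal (i + 1) cs') * t' := by ring

/-! ### Family `LINπ` and its checker -/

/-- `linPiFamily H`: `x = (a₀ + c₁π + c₂π² + c₃π³ + c₄ log 2)/aₓ` with `c = [c₁, c₂, c₃, c₄] ≠ 0`, at most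
two `cᵢ ≠ 0`, `|cᵢ| ≤ H`, `1 ≤ aₓ ≤ H`, `a₀ ∈ ℤ` (FAMILIES-v1 LIN restricted to the constants
`π, π², π³, log 2`; the table has `H = 12`; tuples need not be primitive — a superset). -/
def linPiFamily (H : ℕ) : Set ℝ :=
  {x | ∃ (a₀ : ℤ) (c : List ℤ) (ax : ℕ), c.length = 4 ∧ 1 ≤ ax ∧ ax ≤ H ∧
    (∀ y ∈ c, -(H : ℤ) ≤ y ∧ y ≤ H) ∧ (c.filter (· ≠ 0)).length ≤ 2 ∧ c ≠ [0, 0, 0, 0] ∧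
    x = ((a₀ : ℝ) + linVal 0 c) / ax}

/-- A listed LIN tuple `(a₀, [c₁, c₂, c₃, c₄], aₓ)` and its value. -/
noncomputable def linTupleVal (e : ℤ × List ℤ × ℕ) : ℝ := ((e.1 : ℝ) + linVal 0 e.2.1) / e.2.2

/-- Bounded loop over `k` further integer entries in `[−H, H]` with at most `budget` of them non-zero
(with no budget left the remaining entries are `0`). -/
def loopNZ (H : ℤ) : ℕ → ℕ → List ℤ → (List ℤ → Bool) → Bool
  | 0, _, acc, f => f acc
  | k + 1, 0, acc, f => loopNZ H k 0 (acc ++ [0]) f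
  | k + 1, bud + 1, acc, f => allIntIcc (-H) H fun v =>
      if v = 0 then loopNZ H k (bud + 1) (acc ++ [0]) f else loopNZ H k bud (acc ++ [v]) f

/-- Soundness of `loopNZ`. -/
theorem loopNZ_sound {H : ℤ} {f : List ℤ → Bool} : ∀ (k budget : ℕ) (acc : List ℤ),
    loopNZ H k budget acc f = true → ∀ pre : List ℤ, pre.length = k →
      (∀ y ∈ pre, -H ≤ y ∧ y ≤ H) → (pre.filter (· ≠ 0)).length ≤ budget → f (acc ++ pre) = true
  | 0, _, acc, h, pre, hlen, _, _ => by
      rw [List.eq_nil_of_length_eq_zero hlen, List.append_nil]; simpa [loopNZ] using h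
  | k + 1, 0, acc, h, pre, hlen, hb, hnz => by
      cases pre with
      | nil => simp at hlen
      | cons v pre' =>
        have hv0 : v = 0 := by
          by_contra hv0
          have : (List.filter (· ≠ 0) (v :: pre')).length = (pre'.filter (· ≠ 0)).length + 1 := by
            simp [hv0]
          omega
        subst hv0
        unfold loopNZ at h
        have hnz' : (pre'.filter (· ≠ 0)).length ≤ 0 := by simpa using hnz
        simpa using loopNZ_sound k 0 (acc ++ [0]) h pre' (by simpa using hlen)
          (fun y hy => hb y (List.mem_cons_of_mem _ hy)) hnz'
  | k + 1, bud + 1, acc, h, pre, hlen, hb, hnz => by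
      cases pre with
      | nil => simp at hlen
      | cons v pre' =>
        have hv := hb v (by simp)
        unfold loopNZ at h
        have h1 := allIntIcc_sound h hv.1 hv.2
        have hb' : ∀ y ∈ pre', -H ≤ y ∧ y ≤ H := fun y hy => hb y (List.mem_cons_of_mem v hy)
        have hlen' : pre'.length = k := by simpa using hlen
        by_cases hv0 : v = 0
        · subst hv0
          rw [if_pos rfl] at h1
          have hnz' : (pre'.filter (· ≠ 0)).length ≤ bud + 1 := by simpa using hnz
          simpa using loopNZ_sound k (bud + 1) (acc ++ [0]) h1 pre' hlen' hb' hnz'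
        · rw [if_neg hv0] at h1
          have hcount : (List.filter (· ≠ 0) (v :: pre')).length = (pre'.filter (· ≠ 0)).length + 1 := by
            simp [hv0]
          have hnz' : (pre'.filter (· ≠ 0)).length ≤ bud := by omega
          simpa using loopNZ_sound k bud (acc ++ [v]) h1 pre' hlen' hb' hnz'

/-- One candidate `(a₀, c, aₓ)` with `T` the enclosure of `Σ cᵢKᵢ`: decidably outside `[a, b]`, or
proportional to a listed tuple with positive denominator. -/
def linCandOK (a b : ℚ) (ex : List (ℤ × List ℤ × ℕ)) (c : List ℤ) (ax : ℕ) (T : ℚ × ℚ) (a₀ : ℤ) :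
    Bool :=
  decide ((a₀ : ℚ) + T.2 < a * ax) || decide (b * ax < (a₀ : ℚ) + T.1) ||
    ex.any fun e => decide (0 < e.2.2 ∧ a₀ * (e.2.2 : ℤ) = e.1 * ax ∧
      c.map (· * (e.2.2 : ℤ)) = e.2.1.map (· * (ax : ℤ)))

/-- Leaf for a coefficient vector `c`: skip `c = 0`; otherwise for each `aₓ ∈ [1, H]` the candidates
`⌈a aₓ − T.hi⌉ ≤ a₀ ≤ ⌊b aₓ − T.lo⌋`. -/
def linLeaf (H : ℕ) (a b : ℚ) (ex : List (ℤ × List ℤ × ℕ)) (T : ℚ × ℚ) (c : List ℤ) : Bool :=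
  decide (c = [0, 0, 0, 0]) ||
    (List.range' 1 H).all fun ax =>
      allIntIcc ⌈a * ax - T.2⌉ ⌊b * ax - T.1⌋ (linCandOK a b ex c ax T)

/-- The LINπ checker (table height `H`; FAMILIES-v1: `H = 12`). -/
def linPiExcluded (H : ℕ) (a b : ℚ) (ex : List (ℤ × List ℤ × ℕ)) : Bool :=
  loopNZ H 4 2 [] fun c => linLeaf H a b ex (linEncl 0 c) c

/-- **Soundness of the LINπ sentence.** If `linPiExcluded H a b ex = true` then every member of
`linPiFamily H` in `[a, b]` equals the value of a listed tuple. -/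
theorem linPiExcluded_sound {H : ℕ} {a b : ℚ} {ex : List (ℤ × List ℤ × ℕ)}
    (hc : linPiExcluded H a b ex = true) {x : ℝ} (hx : (a : ℝ) ≤ x ∧ x ≤ b)
    (hmem : x ∈ linPiFamily H) : ∃ e ∈ ex, x = linTupleVal e := by
  obtain ⟨a₀, c, ax, hlen, hax1, haxH, hcb, hnz, hc0, rfl⟩ := hmem
  obtain ⟨hT1, hT2⟩ := linVal_mem 0 c
  set T := linEncl 0 c with hT
  have hax0 : (0 : ℝ) < ax := by exact_mod_cast hax1
  unfold linPiExcluded at hc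
  have h1 := loopNZ_sound 4 2 [] hc c hlen hcb hnz
  simp only [List.nil_append, linLeaf, Bool.or_eq_true, decide_eq_true_eq] at h1
  rcases h1 with h1 | h1
  · exact absurd h1 hc0
  · have h2 := List.all_eq_true.mp h1 ax (List.mem_range'_1.mpr ⟨hax1, by omega⟩)
    -- a ax ≤ a₀ + V ≤ b ax
    have hlo' : (a : ℝ) * ax ≤ a₀ + linVal 0 c := by
      have := mul_le_mul_of_nonneg_right hx.1 hax0.le; rwa [div_mul_cancel₀ _ hax0.ne'] at this
    have hhi' : (a₀ : ℝ) + linVal 0 c ≤ b * ax := by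
      have := mul_le_mul_of_nonneg_right hx.2 hax0.le; rwa [div_mul_cancel₀ _ hax0.ne'] at this
    have hlo : ⌈a * ax - T.2⌉ ≤ a₀ := by
      rw [Int.ceil_le]
      have : (a : ℝ) * ax - T.2 ≤ a₀ := by linarith
      exact_mod_cast this
    have hhi : a₀ ≤ ⌊b * ax - T.1⌋ := by
      rw [Int.le_floor]
      have : (a₀ : ℝ) ≤ b * ax - T.1 := by linarith
      exact_mod_cast this
    have h3 := allIntIcc_sound h2 hlo hhi
    unfold linCandOK at h3
    simp only [Bool.or_eq_true, decide_eq_true_eq, List.any_eq_true] at h3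
    rcases h3 with (h3 | h3) | ⟨e, he, he0, hea, hec⟩
    · exfalso
      have h4 : (((a₀ : ℚ) + T.2 : ℚ) : ℝ) < ((a * ax : ℚ) : ℝ) := Rat.cast_lt.mpr h3
      push_cast at h4; linarith
    · exfalso
      have h4 : ((b * ax : ℚ) : ℝ) < (((a₀ : ℚ) + T.1 : ℚ) : ℝ) := Rat.cast_lt.mpr h3
      push_cast at h4; linarith
    · refine ⟨e, he, ?_⟩
      unfold linTupleVal
      have he0' : (0 : ℝ) < e.2.2 := by exact_mod_cast he0
      rw [div_eq_div_iff hax0.ne' he0'.ne']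
      have hv := linVal_mul_eq 0 c e.2.1 hec
      push_cast at hv
      have hea' : (a₀ : ℝ) * e.2.2 = e.1 * ax := by exact_mod_cast hea
      calc ((a₀ : ℝ) + linVal 0 c) * e.2.2 = (a₀ : ℝ) * e.2.2 + linVal 0 c * e.2.2 := by ring
        _ = (e.1 : ℝ) * ax + linVal 0 e.2.1 * ax := by rw [hea', hv]
        _ = ((e.1 : ℝ) + linVal 0 e.2.1) * ax := by ring

/-! ### Bridges from the floor's statements (both `π`-sub-families) -/

/-- **TRGπ sentence for `Δ_σ`.** Under `IsingEnclosure W R` with the `Δ_σ`-projection of `R` in `[a, b]`: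
if `Δ_σ` is a TRG form `(p/q)·u·π^(a/2)·L^s` of the stated bounds, it equals a listed tuple's value. -/
theorem sigma_trgPi_covered_of_isingEnclosure {W R : Set (ℝ × ℝ)} (h : IsingEnclosure W R) {a b : ℚ}
    (hR : ∀ q ∈ R, (a : ℝ) ≤ q.1 ∧ q.1 ≤ b) {Dm hh : ℕ} {ex : List (ℕ × ℕ × ℕ × ℤ × ℕ × ℤ)}
    (hx : trgPiExcluded Dm hh a b ex = true) (D : SigmaEpsilonData) (hD : D.SatisfiesBootstrapAxioms)
    (hW : (D.Δσ, D.Δε) ∈ W) (hmem : D.Δσ ∈ trgPiFamily Dm hh) : ∃ e ∈ ex, D.Δσ = trgTupleVal e :=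
  trgPiExcluded_sound hx (hR _ (h D hD hW)) hmem

/-- **TRGπ sentence for `Δ_ε`.** -/
theorem eps_trgPi_covered_of_isingEnclosure {W R : Set (ℝ × ℝ)} (h : IsingEnclosure W R) {a b : ℚ}
    (hR : ∀ q ∈ R, (a : ℝ) ≤ q.2 ∧ q.2 ≤ b) {Dm hh : ℕ} {ex : List (ℕ × ℕ × ℕ × ℤ × ℕ × ℤ)}
    (hx : trgPiExcluded Dm hh a b ex = true) (D : SigmaEpsilonData) (hD : D.SatisfiesBootstrapAxioms)
    (hW : (D.Δσ, D.Δε) ∈ W) (hmem : D.Δε ∈ trgPiFamily Dm hh) : ∃ e ∈ ex, D.Δε = trgTupleVal e :=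
  trgPiExcluded_sound hx (hR _ (h D hD hW)) hmem

/-- **LINπ sentence for `Δ_σ`.** -/
theorem sigma_linPi_covered_of_isingEnclosure {W R : Set (ℝ × ℝ)} (h : IsingEnclosure W R) {a b : ℚ}
    (hR : ∀ q ∈ R, (a : ℝ) ≤ q.1 ∧ q.1 ≤ b) {H : ℕ} {ex : List (ℤ × List ℤ × ℕ)}
    (hx : linPiExcluded H a b ex = true) (D : SigmaEpsilonData) (hD : D.SatisfiesBootstrapAxioms)
    (hW : (D.Δσ, D.Δε) ∈ W) (hmem : D.Δσ ∈ linPiFamily H) : ∃ e ∈ ex, D.Δσ = linTupleVal e :=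
  linPiExcluded_sound hx (hR _ (h D hD hW)) hmem

/-- **LINπ sentence for `Δ_ε`.** -/
theorem eps_linPi_covered_of_isingEnclosure {W R : Set (ℝ × ℝ)} (h : IsingEnclosure W R) {a b : ℚ}
    (hR : ∀ q ∈ R, (a : ℝ) ≤ q.2 ∧ q.2 ≤ b) {H : ℕ} {ex : List (ℤ × List ℤ × ℕ)}
    (hx : linPiExcluded H a b ex = true) (D : SigmaEpsilonData) (hD : D.SatisfiesBootstrapAxioms)
    (hW : (D.Δσ, D.Δε) ∈ W) (hmem : D.Δε ∈ linPiFamily H) : ∃ e ∈ ex, D.Δε = linTupleVal e :=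
  linPiExcluded_sound hx (hR _ (h D hD hW)) hmem

end Summit.CriticalPhenomena.Ising3D
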